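import Literature.Probability.LatticeModels.RandomClusterEdgeWeights
import HarnessLib

/-!
# The random-cluster measure with `q ≤ 1` is Rayleigh (edge-negatively associated) on series–parallel graphs (Wagner 2008)

Topic `Literature/Probability/LatticeModels`.  D. G. Wagner, *Negatively correlated random variables and Mason's conjecture for
independent sets in matroids*, Ann. Comb. 12 (2008) 211–239 (arXiv:math/0602648): the Potts-model partition function
`Z(M, q; y) = ∑_{S ⊆ E} q^{−rank S} y^S` of a matroid `M` is RAYLEIGH — `Z^e_f Z^f_e ≥ Z^{ef} Z_{ef}` for all `y ∈ (0,∞)^E` — for every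
uniform matroid and all `0 < q ≤ 1` (Example 5.1), the Rayleigh condition is preserved by two-sums with the range of `q` preserved
(Theorem 5.8(d)) and by minors (§5.2: `q_c(M) ≤ q_c(M/g)`, `q_c(M) ≤ q_c(M∖g)`), and consequently "the class of Potts–Rayleigh matroids
… contains all series–parallel graphs" (§5.3).  For the cycle matroid of a finite graph `G`, `q^{−rank S} = q^{k(S) − |V|}`, `y_e = p_e/(1−p_e)`,
and the Rayleigh inequality at `(e,f)` is exactly EDGE-NEGATIVE ASSOCIATION of the random-cluster measure `φ_{G,𝐩,q}`
(Grimmett 2006 §3.9 eq. (3.94)): `φ(J_e ∩ J_f) ≤ φ(J_e) φ(J_f)`.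

This file records, in the tree's vocabulary (`rcMeasureW w q ∅` on a finite vertex type, weights `w ∈ [0,1]^{Sym2 V}`; Grimmett's
(1.20)), the graph case of Wagner's theorem as a NAMED FACT (statement only):
* `HasK4Minor G` — `G` has a `K₄` minor, by branch sets (four pairwise disjoint nonempty connected vertex sets, pairwise joined by an
  edge); the finite graphs with no `K₄` minor are exactly the series–parallel graphs (Dirac 1952 / Duffin 1965);
* `Wagner2008_rc_edgeNegCorr_of_noK4Minor` — for `0 < q ≤ 1` and every weight vector whose support graph has no `K₄` minor,
  `φ_{w,q}(J_e ∩ J_f) ≤ φ_{w,q}(J_e) φ_{w,q}(J_f)` for all pairs `e ≠ f`, `e` not a loop.  Parameters equal to `1` are allowed: a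
  weight-`1` pair `g` makes `φ_{w,q}` the random-cluster measure of the contraction `G/g` (a minor of a series–parallel graph, hence
  series–parallel), for which Wagner's theorem applies by §5.2; parameters equal to `0` delete the pair.
-- TODO(general form): Wagner proves the Rayleigh property of `Z(M, q; y)` for every series–parallel MATROID and all `y > 0`,
-- `0 < q ≤ 1`; only the graphic case in negative-correlation form is stated here (no matroid Potts model in the tree).

## References
* [Wagner2006] D. G. Wagner, Negatively correlated random variables and Mason's conjecture for independent sets in matroids,
  Ann. Comb. 12 (2008) 211–239; arXiv:math/0602648: Ex. 5.1, Thm. 5.8(d), §5.2, §5.3.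
* [Grimmett2006] G. Grimmett, The Random-Cluster Model, Springer 2006: §1.4 eq. (1.20); §3.9 eq. (3.94).
-/

noncomputable section

namespace Literature.Probability.LatticeModels

open MeasureTheory Literature.Probability.Percolation
open scoped Classical

/-- **A `K₄` minor by branch sets**: four pairwise disjoint, nonempty vertex sets, each inducing a connected subgraph, every two of
which are joined by an edge of `G`.  A finite graph has no `K₄` minor iff it is series–parallel (every block is a series–parallel
network; Dirac 1952, Duffin 1965). [cite: Wagner2006, §5.3] -/
def HasK4Minor {V : Type*} (G : SimpleGraph V) : Prop :=
  ∃ B : Fin 4 → Set V,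
    (∀ i, (B i).Nonempty) ∧ (∀ i, (G.induce (B i)).Connected) ∧ (∀ i j, i ≠ j → Disjoint (B i) (B j)) ∧
      (∀ i j, i ≠ j → ∃ a ∈ B i, ∃ b ∈ B j, G.Adj a b)

/-- **Wagner 2008 (graph case, negative-correlation form): for `0 < q ≤ 1` the random-cluster measure `φ_{w,q}` is
edge-negatively associated whenever the support graph of `w` has no `K₄` minor (is series–parallel):**
`φ_{w,q}(J_e ∩ J_f) ≤ φ_{w,q}(J_e)·φ_{w,q}(J_f)` for all pairs `f ≠ e`, `e` not a loop.  Weight-`1` pairs (contractions) and weight-`0`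
pairs (deletions) are covered by the closure of the Potts–Rayleigh class under minors (§5.2).  NAMED FACT, statement only.
[cite: Wagner2006, Ex. 5.1, Thm. 5.8(d), §5.2, §5.3] [cite: Grimmett2006, §3.9 eq. (3.94) (p. 63); §1.4 eq. (1.20) (p. 15)] -/
def Wagner2008_rc_edgeNegCorr_of_noK4Minor : Prop :=
  ∀ (n : ℕ) (w : Sym2 (Fin n) → unitInterval) (q : ℝ), 0 < q → q ≤ 1 →
    ¬ HasK4Minor (SimpleGraph.fromEdgeSet {e : Sym2 (Fin n) | ((w e : unitInterval) : ℝ) ≠ 0}) →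
    ∀ e f : Sym2 (Fin n), ¬ e.IsDiag → f ≠ e →
      (rcMeasureW w q ∅).real ({ω | e ∈ ω} ∩ {ω | f ∈ ω}) ≤
        (rcMeasureW w q ∅).real {ω | e ∈ ω} * (rcMeasureW w q ∅).real {ω | f ∈ ω}

end Literature.Probability.LatticeModels

end
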